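import Literature.NumberTheory.GaloisRepresentations.ArtinConductorInductionLocal
import Mathlib.NumberTheory.NumberField.Discriminant.Different
import Mathlib.RingTheory.Ideal.Norm.RelNorm
import Mathlib.LinearAlgebra.FreeModule.IdealQuotient
import HarnessLib

/-!
# The different of a Galois extension divides the product of the differents of a separating family of subfields; discriminant of the Galois closure

Topic `Literature/NumberTheory/NumberFields`, namespace `Literature.NumberTheory.NumberFields`.
Everything in this file is PROVED (theorems only), over the tree's ramification/different API
(`Literature/NumberTheory/GaloisRepresentations/ArtinConductorInductionLocal.lean`: Serre's
`i_G = lowerIndex`, Hilbert's different formula, the corollary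
`card_inertia_mul_emultiplicity_differentIdeal_under_eq_sum_lowerIndex`).

The classical input of Stark's "no exceptional zero without a quadratic subfield"
([Stark1974, §3]: the Galois closure `N` of a field `K` of degree `n` has `log|d_N| ≤ [N:ℚ] log|d_K|`,
whence his region `1 − 1/(4 n! log|d_K|)` from `[N:ℚ] ≤ n!`) in the following general form.
Let `R` be Dedekind with fraction field `K₀`, `L/K₀` finite Galois with group `G`,
`S = integralClosure R L`, and `(F_i)_{i ∈ t}` intermediate fields SEPARATING `G` (every `s ≠ 1`
moves some `F_i`, i.e. `s ∉ Gal(L/F_i)`; e.g. the conjugates of a subfield whose Galois closure is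
`L`, or the images of all embeddings of `K` into its Galois closure). At every prime `𝔓` of `S`
(Serre, *Local Fields*, IV §1 Prop. 4 and its Corollary):

  `v_𝔓(𝔇_{S/R}) = Σ_{s ≠ 1} i_𝔓(s)`,   `v_𝔓(𝔇_{S_{F_i}/R} S) = Σ_{s ∉ Gal(L/F_i)} i_𝔓(s)`,

and every `s ≠ 1` occurs in at least one of the right-hand sums, so

* `differentIdeal_dvd_prod_map_differentIdeal` — **`𝔇_{S/R} ∣ ∏_i 𝔇_{S_{F_i}/R} S`**;
* `natAbs_discr_dvd_prod_pow_of_isGalois` — for a Galois NUMBER FIELD `N` and such a family: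
  **`|d_N| ∣ ∏_i |d_{F_i}|^{[N : F_i]}`** (norms: `N(𝔇_{N/ℚ}) = |d_N|` and
  `N(𝔇_{F_i/ℚ} 𝓞_N) = |d_{F_i}|^{[N:F_i]}`, `absNorm_map_differentIdeal_eq_natAbs_discr_pow`).

Auxiliary: `emultiplicity_differentIdeal_eq_sum_lowerIndex` (Hilbert's formula at an arbitrary
prime, via the decomposition field), `emultiplicity_map_differentIdeal_eq_sum_lowerIndex`,
`Ideal.dvd_of_forall_emultiplicity_le` (divisibility of ideals from multiplicities, dot-notation
extension of Mathlib's `Ideal` declared with its absolute name), `sum_ne_one_le_sum_sum_not_mem`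
(the counting step).

## References

* J.-P. Serre, *Local Fields*, GTM 67, Springer 1979, Ch. IV §1 Prop. 4 and Corollary; Ch. III §4
  Prop. 8. [SerreLocalFields1979]
* H. M. Stark, *Some effective cases of the Brauer–Siegel theorem*, Invent. Math. 23 (1974)
  135–152, §3. [Stark1974]
-/

open scoped Pointwise NumberField

noncomputable section

open Finset IsDedekindDomain Field Module NumberField

namespace Literature.NumberTheory.NumberFields

open Literature.NumberTheory.GaloisRepresentations

section Different

attribute [local instance] Ideal.Quotient.field FractionRing.liftAlgebra
  FractionRing.isScalarTower_liftAlgebra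

variable (R : Type*) {K L : Type*} [CommRing R] [IsDedekindDomain R] [Field K] [Field L]
  [Algebra R K] [IsFractionRing R K] [Algebra R L] [Algebra K L] [IsScalarTower R K L]
  [FiniteDimensional K L] [IsGalois K L]

attribute [local instance] integralClosureAlgebra integralClosure_isScalarTower_left
  integralClosure_isScalarTower_bot integralClosure_faithfulSMul integralClosure_isIntegral
  integralClosure_isTorsionFree isMaximal_under_integralClosure under_integralClosure_liesOver
  residueAlgebra residueSMul isScalarTower_residue

attribute [local instance] integralClosure_moduleFinite

/-- **Hilbert's different formula at an arbitrary prime of a Galois extension of Dedekind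
domains** (Serre, *Local Fields*, Ch. IV §1 Prop. 4, globalised): `v_𝔓(𝔇_{S/R}) = Σ_{s ≠ 1} i_𝔓(s)`
(the sum is really over `D_𝔓 ∖ {1}`, `i_𝔓 = 0` off `D_𝔓`): Hilbert's formula for `S/S_Z` with `Z`
the decomposition field (`emultiplicity_differentIdeal_eq_finsum_add_card_mul`) and
`v_{𝔓_Z}(𝔇_{S_Z/R}) = 0` (`𝔓_Z` is unramified over `R`).
[cite: SerreLocalFields1979, Ch. IV §1 Prop. 4] -/
theorem emultiplicity_differentIdeal_eq_sum_lowerIndex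
    [IsDedekindDomain (integralClosure R L)] [Module.IsTorsionFree R (integralClosure R L)]
    [CharZero R] [CharZero L] [Fintype (L ≃ₐ[K] L)] [DecidableEq (L ≃ₐ[K] L)]
    (𝔓 : Ideal (integralClosure R L)) [𝔓.IsMaximal] (h𝔓 : 𝔓 ≠ ⊥)
    [Finite (integralClosure R L ⧸ 𝔓)] :
    emultiplicity 𝔓 (differentIdeal R (integralClosure R L)) =
      ∑ s ∈ Finset.univ.filter (· ≠ (1 : L ≃ₐ[K] L)), lowerIndex 𝔓 (L ≃ₐ[K] L) s := by
  classical
  haveI h𝔓prime : 𝔓.IsPrime := Ideal.IsMaximal.isPrime inferInstance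
  haveI : FaithfulSMul (L ≃ₐ[K] L) (integralClosure R L) := faithfulSMul_algEquiv_integralClosure R
  haveI : IsFractionRing (integralClosure R L) L :=
    integralClosure.isFractionRing_of_finite_extension K L
  haveI : (𝔓.under R).IsMaximal := Ideal.IsMaximal.under R 𝔓
  haveI : Algebra.IsSeparable (R ⧸ 𝔓.under R) (integralClosure R L ⧸ 𝔓) :=
    isSeparable_residue_of_finite 𝔓
  haveI : Finite (R ⧸ 𝔓.under R) := Finite.of_injective _ Ideal.algebraMap_quotient_injective
  haveI : Module.Finite R (integralClosure R L) :=
    IsIntegralClosure.finite R K L (integralClosure R L)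
  haveI : FaithfulSMul R (integralClosure R L) := faithfulSMul_integralClosure R (K := K) (L := L)
  haveI : IsGaloisGroup (L ≃ₐ[K] L) R (integralClosure R L) :=
    IsGaloisGroup.of_isFractionRing _ _ _ K L
  set D : Subgroup (L ≃ₐ[K] L) := 𝔓.decompositionSubgroup (L ≃ₐ[K] L) with hD
  set I : Subgroup (L ≃ₐ[K] L) := 𝔓.inertia (L ≃ₐ[K] L) with hI
  have hID : I ≤ D := Ideal.inertia_le_stabilizer 𝔓
  set F₁ : IntermediateField K L := IntermediateField.fixedField D with hF₁
  have hΓ₁ : F₁.fixingSubgroup = D := IntermediateField.fixingSubgroup_fixedField D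
  haveI : IsDedekindDomain (integralClosure R F₁) := integralClosure.isDedekindDomain R K F₁
  haveI : Module.IsTorsionFree R (integralClosure R F₁) := by
    rw [Module.isTorsionFree_iff_faithfulSMul]
    exact faithfulSMul_integralClosure R (K := K) (L := F₁)
  have heR : 𝔓.ramificationIdx R = Nat.card I := by
    rw [← Ideal.ramificationIdxIn_eq_ramificationIdx (𝔓.under R) 𝔓 (L ≃ₐ[K] L),
      card_inertia_eq_ramificationIdxIn_of_isSeparable (G := L ≃ₐ[K] L) (𝔓.under R) 𝔓]
  have heF : ∀ F' : IntermediateField K L, [IsDedekindDomain (integralClosure R F')] →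
      𝔓.ramificationIdx (integralClosure R F') = Nat.card ↥(F'.fixingSubgroup ⊓ I) := by
    intro F' _
    have hp : 𝔓.under (integralClosure R F') ≠ ⊥ := Ideal.IsIntegral.comap_ne_bot _ h𝔓
    rw [← Ideal.ramificationIdx'_eq_ramificationIdx _ 𝔓 hp,
      ramificationIdx'_under_eq_card_inertia R F' 𝔓 h𝔓, card_inertia_subgroup_eq R]
  have hDI : D ⊓ I = I := inf_eq_right.mpr hID
  have he₁ : (𝔓.under (integralClosure R F₁)).ramificationIdx R = 1 := by
    have ht := Ideal.ramificationIdx_tower (R := R) (𝔓.under (integralClosure R F₁)) 𝔓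
    rw [heR, heF F₁, hΓ₁, hDI] at ht
    exact (Nat.eq_of_mul_eq_mul_right Nat.card_pos ((one_mul _).trans ht)).symm
  have hm₁ : emultiplicity (𝔓.comap (F₁.integralClosureInclusion R))
      (differentIdeal R (integralClosure R F₁)) = 0 := by
    have hcomap : 𝔓.comap (F₁.integralClosureInclusion R) = 𝔓.under (integralClosure R F₁) :=
      Ideal.ext fun _ => Iff.rfl
    rw [hcomap]
    haveI : Finite (R ⧸ (𝔓.under (integralClosure R F₁)).under R) := by
      rw [Ideal.under_under]; infer_instance
    haveI : Module.Finite R (integralClosure R F₁) :=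
      IsIntegralClosure.finite R K F₁ (integralClosure R F₁)
    exact emultiplicity_differentIdeal_eq_zero_of_ramificationIdx_eq_one _ he₁
  have H1 := emultiplicity_differentIdeal_eq_finsum_add_card_mul R F₁ 𝔓 h𝔓 hΓ₁.le
  rw [hm₁, mul_zero, add_zero] at H1
  rw [H1, finsum_cond_eq_sum_of_cond_iff (t := Finset.univ.filter fun s => s ∈ D ∧ s ≠ 1) _
      (by intro s _; simp only [Finset.mem_filter, Finset.mem_univ, true_and, hΓ₁])]
  -- add the zero terms `s ∉ D`
  rw [← Finset.sum_filter_add_sum_filter_not (Finset.univ.filter fun s : L ≃ₐ[K] L => s ≠ 1) (· ∈ D),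
    Finset.filter_filter, Finset.filter_filter]
  have hzero : ∑ s ∈ Finset.univ.filter (fun s : L ≃ₐ[K] L => s ≠ 1 ∧ s ∉ D),
      lowerIndex 𝔓 (L ≃ₐ[K] L) s = 0 :=
    Finset.sum_eq_zero fun s hs => lowerIndex_eq_zero_of_smul_ne (Finset.mem_filter.mp hs).2.2
  have hfilt : (Finset.univ.filter fun s : L ≃ₐ[K] L => s ≠ 1 ∧ s ∈ D) =
      Finset.univ.filter fun s => s ∈ D ∧ s ≠ 1 :=
    Finset.filter_congr fun s _ => and_comm
  rw [hzero, add_zero, hfilt]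

/-- **The extension of the different of an intermediate field, at an arbitrary prime**:
`v_𝔓(𝔇_{S_F/R} S) = Σ_{s ∉ H} i_𝔓(s)` for `H = Gal(L/F)`: `v_𝔓(𝔇_{S_F/R} S) = e(𝔓|𝔓_F) v_{𝔓_F}(𝔇_{S_F/R})`,
`e(𝔓|𝔓_F) = #(T_𝔓 ∩ H)`, and Serre's corollary
`#(T_𝔓 ∩ H) · v_{𝔓_F}(𝔇_{S_F/R}) = Σ_{s ∉ H} i_𝔓(s)` (the tree's
`card_inertia_mul_emultiplicity_differentIdeal_under_eq_sum_lowerIndex`).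
[cite: SerreLocalFields1979, Ch. IV §1, Cor. to Prop. 4] -/
theorem emultiplicity_map_differentIdeal_eq_sum_lowerIndex
    [IsDedekindDomain (integralClosure R L)] [Module.IsTorsionFree R (integralClosure R L)]
    (F : IntermediateField K L) [IsDedekindDomain (integralClosure R F)]
    [Module.IsTorsionFree R (integralClosure R F)] [CharZero R] [CharZero L]
    [Fintype (L ≃ₐ[K] L)] [DecidablePred (· ∈ F.fixingSubgroup)]
    (𝔓 : Ideal (integralClosure R L)) [𝔓.IsMaximal] (h𝔓 : 𝔓 ≠ ⊥)
    [Finite (integralClosure R L ⧸ 𝔓)] :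
    emultiplicity 𝔓 ((differentIdeal R (integralClosure R F)).map
        (algebraMap (integralClosure R F) (integralClosure R L))) =
      ∑ s ∈ Finset.univ.filter (· ∉ F.fixingSubgroup), lowerIndex 𝔓 (L ≃ₐ[K] L) s := by
  classical
  haveI h𝔓prime : 𝔓.IsPrime := Ideal.IsMaximal.isPrime inferInstance
  haveI : FaithfulSMul (L ≃ₐ[K] L) (integralClosure R L) := faithfulSMul_algEquiv_integralClosure R
  haveI : IsFractionRing (integralClosure R L) L :=
    integralClosure.isFractionRing_of_finite_extension K L
  haveI : Module.Finite R (integralClosure R L) :=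
    IsIntegralClosure.finite R K L (integralClosure R L)
  haveI : Module.Finite R (integralClosure R F) :=
    IsIntegralClosure.finite R K F (integralClosure R F)
  haveI : FaithfulSMul R (integralClosure R L) := faithfulSMul_integralClosure R (K := K) (L := L)
  haveI : (𝔓.under R).IsMaximal := Ideal.IsMaximal.under R 𝔓
  haveI : Algebra.IsSeparable (R ⧸ 𝔓.under R) (integralClosure R L ⧸ 𝔓) :=
    isSeparable_residue_of_finite 𝔓
  -- valuation of an extended ideal
  have h𝔭ne : 𝔓.under (integralClosure R F) ≠ ⊥ := Ideal.IsIntegral.comap_ne_bot _ h𝔓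
  haveI : (𝔓.under (integralClosure R F)).IsMaximal := Ideal.IsMaximal.under _ 𝔓
  have hne : differentIdeal R (integralClosure R F) ≠ ⊥ := differentIdeal_ne_bot
  have hmap := Ideal.IsDedekindDomain.emultiplicity_map_eq_ramificationIdx'_mul
    (R := integralClosure R F) (S := integralClosure R L) (v := 𝔓.under (integralClosure R F))
    (w := 𝔓) hne (Ideal.prime_of_isPrime h𝔭ne inferInstance).irreducible
    (Ideal.prime_of_isPrime h𝔓 inferInstance).irreducible h𝔓
  rw [hmap, ramificationIdx'_under_eq_card_inertia R F 𝔓 h𝔓]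
  exact card_inertia_mul_emultiplicity_differentIdeal_under_eq_sum_lowerIndex R F 𝔓 h𝔓

omit [IsFractionRing R K] [FiniteDimensional K L] [IsGalois K L] in
/-- In a Dedekind domain, divisibility of non-zero ideals is tested on the multiplicities at the
non-zero maximal ideals. [folklore] -/
theorem _root_.Ideal.dvd_of_forall_emultiplicity_le {S : Type*} [CommRing S] [IsDedekindDomain S]
    {A B : Ideal S} (hA : A ≠ ⊥) (hB : B ≠ ⊥)
    (h : ∀ P : Ideal S, P.IsMaximal → P ≠ ⊥ → emultiplicity P A ≤ emultiplicity P B) : A ∣ B := by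
  classical
  rw [UniqueFactorizationMonoid.dvd_iff_normalizedFactors_le_normalizedFactors hA hB, Multiset.le_iff_count]
  intro P
  by_cases hP : P ∈ UniqueFactorizationMonoid.normalizedFactors A
  · have hprime : Prime P := UniqueFactorizationMonoid.prime_of_normalized_factor P hP
    have hP0 : P ≠ ⊥ := hprime.ne_zero
    haveI : P.IsPrime := Ideal.isPrime_of_prime hprime
    haveI : P.IsMaximal := Ring.DimensionLEOne.maximalOfPrime hP0 inferInstance
    have hle := h P inferInstance hP0
    rw [UniqueFactorizationMonoid.emultiplicity_eq_count_normalizedFactors hprime.irreducible hA,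
      UniqueFactorizationMonoid.emultiplicity_eq_count_normalizedFactors hprime.irreducible hB,
      normalize_eq P] at hle
    exact_mod_cast hle
  · rw [Multiset.count_eq_zero_of_notMem hP]
    exact Nat.zero_le _

omit [IsDedekindDomain R] [IsFractionRing R K] [FiniteDimensional K L] [IsGalois K L] in
/-- The combinatorial step: if every `s ≠ 1` lies outside `H_i` for some `i ∈ t`, then
`Σ_{s ≠ 1} w(s) ≤ Σ_{i ∈ t} Σ_{s ∉ H_i} w(s)` for every weight `w : G → ℕ∞`. [folklore] -/
theorem sum_ne_one_le_sum_sum_not_mem {G : Type*} [Group G] [Fintype G] [DecidableEq G]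
    {ι : Type*} (t : Finset ι) (H : ι → Subgroup G) [∀ i, DecidablePred (· ∈ H i)]
    (hsep : ∀ s : G, s ≠ 1 → ∃ i ∈ t, s ∉ H i) (w : G → ℕ∞) :
    ∑ s ∈ Finset.univ.filter (· ≠ (1 : G)), w s ≤
      ∑ i ∈ t, ∑ s ∈ Finset.univ.filter (· ∉ H i), w s := by
  have hswap : ∑ i ∈ t, ∑ s ∈ Finset.univ.filter (· ∉ H i), w s =
      ∑ s : G, (t.filter fun i => s ∉ H i).card • w s := by
    simp_rw [Finset.sum_filter]
    rw [Finset.sum_comm]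
    refine Finset.sum_congr rfl fun s _ => ?_
    rw [← Finset.sum_filter, Finset.sum_const]
  rw [hswap]
  calc ∑ s ∈ Finset.univ.filter (· ≠ (1 : G)), w s
      ≤ ∑ s ∈ Finset.univ.filter (· ≠ (1 : G)), (t.filter fun i => s ∉ H i).card • w s := by
        refine Finset.sum_le_sum fun s hs => ?_
        obtain ⟨i, hit, hi⟩ := hsep s (Finset.mem_filter.mp hs).2
        have hcard : 1 ≤ (t.filter fun i => s ∉ H i).card :=
          Finset.card_pos.mpr ⟨i, Finset.mem_filter.mpr ⟨hit, hi⟩⟩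
        calc w s = 1 • w s := (one_nsmul _).symm
          _ ≤ (t.filter fun i => s ∉ H i).card • w s := nsmul_le_nsmul_left (zero_le) hcard
    _ ≤ ∑ s : G, (t.filter fun i => s ∉ H i).card • w s :=
        Finset.sum_le_sum_of_subset_of_nonneg (Finset.filter_subset _ _) fun x _ _ => zero_le

/-- **The different of a Galois extension divides the product of the (extended) differents of a
separating family of intermediate fields.** `R` Dedekind, `L/K` finite Galois with group `G`,
`S = integralClosure R L` with finite residue fields, `(F_i)_{i ∈ t}` intermediate fields such that
every `s ≠ 1` in `G` moves some `F_i` (`s ∉ Gal(L/F_i)`; e.g. the conjugates of a subfield whose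
Galois closure is `L`). Then `𝔇_{S/R} ∣ ∏_i 𝔇_{S_{F_i}/R} S`: at every prime `𝔓`,
`v_𝔓(𝔇_{S/R}) = Σ_{s ≠ 1} i_𝔓(s) ≤ Σ_i Σ_{s ∉ Gal(L/F_i)} i_𝔓(s) = Σ_i v_𝔓(𝔇_{S_{F_i}/R} S)` by
Hilbert's formula (`emultiplicity_differentIdeal_eq_sum_lowerIndex`) and Serre's corollary
(`emultiplicity_map_differentIdeal_eq_sum_lowerIndex`). [cite: SerreLocalFields1979, Ch. IV §1 Prop. 4 and Cor.] -/
theorem differentIdeal_dvd_prod_map_differentIdeal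
    [IsDedekindDomain (integralClosure R L)] [Module.IsTorsionFree R (integralClosure R L)]
    [CharZero R] [CharZero L] [Fintype (L ≃ₐ[K] L)] [DecidableEq (L ≃ₐ[K] L)]
    {ι : Type*} (t : Finset ι) (F : ι → IntermediateField K L)
    [∀ i, IsDedekindDomain (integralClosure R (F i))]
    [∀ i, Module.IsTorsionFree R (integralClosure R (F i))]
    [∀ i, DecidablePred (· ∈ (F i).fixingSubgroup)]
    (hfin : ∀ (𝔓 : Ideal (integralClosure R L)), 𝔓.IsMaximal → Finite (integralClosure R L ⧸ 𝔓))
    (hsep : ∀ s : L ≃ₐ[K] L, s ≠ 1 → ∃ i ∈ t, s ∉ (F i).fixingSubgroup) :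
    differentIdeal R (integralClosure R L) ∣
      ∏ i ∈ t, (differentIdeal R (integralClosure R (F i))).map
        (algebraMap (integralClosure R (F i)) (integralClosure R L)) := by
  haveI : Module.Finite R (integralClosure R L) :=
    IsIntegralClosure.finite R K L (integralClosure R L)
  haveI : ∀ i, Module.Finite R (integralClosure R (F i)) := fun i =>
    IsIntegralClosure.finite R K (F i) (integralClosure R (F i))
  have hA : differentIdeal R (integralClosure R L) ≠ ⊥ := differentIdeal_ne_bot
  have hBi : ∀ i ∈ t, (differentIdeal R (integralClosure R (F i))).map
      (algebraMap (integralClosure R (F i)) (integralClosure R L)) ≠ ⊥ := fun i _ =>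
    (Ideal.map_eq_bot_iff_of_injective (FaithfulSMul.algebraMap_injective _ _)).not.mpr
      differentIdeal_ne_bot
  have hB : ∏ i ∈ t, (differentIdeal R (integralClosure R (F i))).map
      (algebraMap (integralClosure R (F i)) (integralClosure R L)) ≠ ⊥ := by
    rw [← Ideal.zero_eq_bot, Finset.prod_ne_zero_iff]
    intro i hi
    rw [Ideal.zero_eq_bot]
    exact hBi i hi
  refine Ideal.dvd_of_forall_emultiplicity_le hA hB fun 𝔓 h𝔓max h𝔓 => ?_
  haveI := h𝔓max
  haveI := hfin 𝔓 h𝔓max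
  have hprime : Prime 𝔓 := Ideal.prime_of_isPrime h𝔓 (Ideal.IsMaximal.isPrime h𝔓max)
  have h1 := emultiplicity_differentIdeal_eq_sum_lowerIndex R (K := K) (L := L) 𝔓 h𝔓
  have h2 := Finset.emultiplicity_prod hprime t (fun i =>
    (differentIdeal R (integralClosure R (F i))).map
      (algebraMap (integralClosure R (F i)) (integralClosure R L)))
  have h3 : ∀ i ∈ t, emultiplicity 𝔓 ((differentIdeal R (integralClosure R (F i))).map
      (algebraMap (integralClosure R (F i)) (integralClosure R L))) =
      ∑ s ∈ Finset.univ.filter (· ∉ (F i).fixingSubgroup), lowerIndex 𝔓 (L ≃ₐ[K] L) s :=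
    fun i _ => emultiplicity_map_differentIdeal_eq_sum_lowerIndex R (F i) 𝔓 h𝔓
  rw [h1, h2, Finset.sum_congr rfl h3]
  exact sum_ne_one_le_sum_sum_not_mem t (fun i => (F i).fixingSubgroup) hsep _

end Different


/-! ### The norm of the extended different (clean number-field statement) -/

section Aux

open NumberField

variable (K 𝒪 : Type*) [Field K] [NumberField K] [CommRing 𝒪] [Algebra 𝒪 K]
  [IsFractionRing 𝒪 K] [IsDedekindDomain 𝒪] [CharZero 𝒪] [Module.Finite ℤ 𝒪]

attribute [local instance] FractionRing.liftAlgebra in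
/-- **`N(𝔇_{K/ℚ} 𝒪') = |d_K|^{[L:K]}`** for number fields `K ⊆ L` with rings of integers
`𝒪 ⊆ 𝒪'` (any models): from `|d_L| = N(𝔇_{𝒪'/𝒪}) · |d_K|^{[L:K]}` (Mathlib's tower formula),
`𝔇_{𝒪'/ℤ} = 𝔇_{𝒪'/𝒪} · 𝔇_{𝒪/ℤ} 𝒪'` and `N(𝔇_{𝒪'/ℤ}) = |d_L|`. [folklore] -/
theorem absNorm_map_differentIdeal_eq_natAbs_discr_pow (L 𝒪' : Type*) [Field L]
    [NumberField L] [CommRing 𝒪'] [Algebra 𝒪' L] [IsFractionRing 𝒪' L]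
    [IsDedekindDomain 𝒪'] [CharZero 𝒪'] [Algebra K L] [Algebra 𝒪 𝒪'] [Algebra 𝒪 L]
    [IsScalarTower 𝒪 K L] [IsScalarTower 𝒪 𝒪' L] [Module.IsTorsionFree 𝒪 𝒪'] [Module.Free ℤ 𝒪']
    [Module.Finite ℤ 𝒪'] [Module.Finite 𝒪 𝒪'] :
    Ideal.absNorm ((differentIdeal ℤ 𝒪).map (algebraMap 𝒪 𝒪')) =
      (discr K).natAbs ^ Module.finrank K L := by
  have htower := natAbs_discr_eq_absNorm_differentIdeal_mul_natAbs_discr_pow K 𝒪 L 𝒪'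
  have htrans := congr_arg Ideal.absNorm
    (differentIdeal_eq_differentIdeal_mul_differentIdeal ℤ 𝒪 𝒪')
  rw [absNorm_differentIdeal L, map_mul, htower] at htrans
  have hne : Ideal.absNorm (differentIdeal 𝒪 𝒪') ≠ 0 := by
    rw [Ne, Ideal.absNorm_eq_zero_iff]
    exact differentIdeal_ne_bot
  exact (mul_left_cancel₀ hne htrans).symm

end Aux

/-! ### Number fields: the discriminant of a Galois extension and a separating family of subfields -/

section NumberField

attribute [local instance] Ideal.Quotient.field

attribute [local instance] integralClosureAlgebra integralClosure_isScalarTower_left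
  integralClosure_isScalarTower_bot integralClosure_faithfulSMul integralClosure_isIntegral
  integralClosure_isTorsionFree isMaximal_under_integralClosure under_integralClosure_liesOver
  residueAlgebra residueSMul isScalarTower_residue

attribute [local instance] integralClosure_moduleFinite

set_option synthInstance.maxHeartbeats 200000 in
-- instance paths through the integral closures of the intermediate fields are long
/-- **Discriminant of a Galois number field versus a separating family of subfields**: if
`N/ℚ` is a finite Galois extension and `(F_i)_{i ∈ t}` are subfields such that every non-trivial
automorphism of `N` moves some `F_i`, then `|d_N| ∣ ∏_i |d_{F_i}|^{[N : F_i]}`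
(norms of `differentIdeal_dvd_prod_map_differentIdeal`: `N(𝔇_{N/ℚ}) = |d_N|`,
`N(𝔇_{F_i/ℚ} 𝓞_N) = |d_{F_i}|^{[N:F_i]}`). [cite: SerreLocalFields1979, Ch. IV §1 Prop. 4 and Cor.; Ch. III §4 Prop. 6] -/
theorem natAbs_discr_dvd_prod_pow_of_isGalois (N : Type*) [Field N] [NumberField N] [IsGalois ℚ N]
    {ι : Type*} (t : Finset ι) (F : ι → IntermediateField ℚ N)
    (hsep : ∀ s : N ≃ₐ[ℚ] N, s ≠ 1 → ∃ i ∈ t, s ∉ (F i).fixingSubgroup) :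
    (discr N).natAbs ∣ ∏ i ∈ t, (discr (F i)).natAbs ^ Module.finrank (F i) N := by
  classical
  -- the integral closures, with their number-field instances
  haveI : IsDedekindDomain (integralClosure ℤ N) := inferInstanceAs (IsDedekindDomain (𝓞 N))
  haveI : Module.Free ℤ (integralClosure ℤ N) := inferInstanceAs (Module.Free ℤ (𝓞 N))
  haveI : Module.Finite ℤ (integralClosure ℤ N) := inferInstanceAs (Module.Finite ℤ (𝓞 N))
  haveI : IsFractionRing (integralClosure ℤ N) N := inferInstanceAs (IsFractionRing (𝓞 N) N)
  haveI : Module.IsTorsionFree ℤ (integralClosure ℤ N) := by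
    rw [Module.isTorsionFree_iff_faithfulSMul]
    exact faithfulSMul_integralClosure ℤ (K := ℚ) (L := N)
  haveI hDi : ∀ i, IsDedekindDomain (integralClosure ℤ (F i)) := fun i =>
    inferInstanceAs (IsDedekindDomain (𝓞 (F i)))
  haveI : ∀ i, Module.Free ℤ (integralClosure ℤ (F i)) := fun i =>
    inferInstanceAs (Module.Free ℤ (𝓞 (F i)))
  haveI : ∀ i, Module.Finite ℤ (integralClosure ℤ (F i)) := fun i =>
    inferInstanceAs (Module.Finite ℤ (𝓞 (F i)))
  haveI : ∀ i, IsFractionRing (integralClosure ℤ (F i)) (F i) := fun i =>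
    inferInstanceAs (IsFractionRing (𝓞 (F i)) (F i))
  haveI : ∀ i, Module.IsTorsionFree ℤ (integralClosure ℤ (F i)) := fun i => by
    rw [Module.isTorsionFree_iff_faithfulSMul]
    exact faithfulSMul_integralClosure ℤ (K := ℚ) (L := F i)
  have hfin : ∀ 𝔓 : Ideal (integralClosure ℤ N), 𝔓.IsMaximal →
      Finite (integralClosure ℤ N ⧸ 𝔓) := fun 𝔓 h𝔓 =>
    Ideal.finiteQuotientOfFreeOfNeBot 𝔓
      (Ring.ne_bot_of_isMaximal_of_not_isField h𝔓 (RingOfIntegers.not_isField N))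
  have hdvd := differentIdeal_dvd_prod_map_differentIdeal ℤ (K := ℚ) (L := N) t F hfin hsep
  have h := map_dvd (Ideal.absNorm (S := integralClosure ℤ N)) hdvd
  have hN : Ideal.absNorm (differentIdeal ℤ (integralClosure ℤ N)) = (discr N).natAbs := by
    convert NumberField.absNorm_differentIdeal N (integralClosure ℤ N)
    exact Subsingleton.elim _ _
  rw [map_prod, hN] at h
  refine h.trans (Finset.prod_dvd_prod_of_dvd _ _ fun i _ => dvd_of_eq ?_)
  -- `N(𝔇_{F_i/ℚ} 𝓞_N) = |d_{F_i}|^{[N : F_i]}`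
  haveI : Module.Finite (integralClosure ℤ (F i)) (integralClosure ℤ N) :=
    Module.Finite.of_restrictScalars_finite ℤ _ _
  convert absNorm_map_differentIdeal_eq_natAbs_discr_pow (F i) (integralClosure ℤ (F i)) N
    (integralClosure ℤ N); exact Subsingleton.elim _ _

end NumberField

end Literature.NumberTheory.NumberFields

end
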